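import Summits.Ventures.PercRepro.C041ZonePortCSDefs

/-!
# THEOREM R-CS on the zone port problem with the validity `V_∧` (no edge between the terminals) — the counts, the
swap, cases (i) and (iii) (p6, gen 28; mine-3's C-041.md §17 (a), REMARK (3): «not written out»)

Setting of `C041ZonePortCSDefs`, with the validity `V_∧` of THEOREM R's `Φ∧` (C-041.md §3 «without 12»): a pattern
is valid when it is admissible with a red 1-edge AND a red 2-edge (`ValidAnd`).  The same counts, (CS) as
`CSAnd P := CS #valid #Good₁ #Good₂`, `Φ∧ = 3·#Good₁ + 3·#Good₂ − 2·#valid` (`phiAnd_eq_counts`,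
`phiAnd_nonneg_of_csAnd`), the swap invariance (`csAnd_swap`), and the cases (i) (`csAnd_of_Z_empty`) and (iii)
(`csAnd_of_forced_gate`) — the proofs of `C041ZonePortCSDefs` with `∨` read as `∧`.
-/

namespace PercRepro

namespace ZonePort

namespace Problem

open Finset CSCount

variable {V E : Type*}

/-- Valid for `V_∧`: admissible with a red 1-edge and a red 2-edge. -/
def ValidAnd (P : Problem V E) (x : P.Term → Bool) : Prop := P.Adm x ∧ (P.X₁ x ∧ P.X₂ x)

section Basic

variable {P : Problem V E}

/-- Validity is unchanged by the swap. -/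
theorem validAnd_swap (x : P.Term → Bool) : P.swap.ValidAnd (P.swapPattern x) ↔ P.ValidAnd x :=
  and_congr (adm_swap x) ((and_congr (X₁_swap x) (X₂_swap x)).trans and_comm)

/-- Without zones no pattern is valid. -/
theorem not_validAnd_of_Z_empty (hZ : P.Z = ∅) (x : P.Term → Bool) : ¬ P.ValidAnd x :=
  fun h => not_X₁_of_Z_empty hZ x h.2.1

end Basic

section Counts

variable [Fintype E] [DecidableEq E] [DecidableEq V] (P : Problem V E)

open Classical in
/-- The valid patterns. -/
noncomputable def validAndSet : Finset (P.Term → Bool) := univ.filter fun x => P.ValidAnd x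

open Classical in
/-- The valid patterns with `Good₁`. -/
noncomputable def good₁AndSet : Finset (P.Term → Bool) := univ.filter fun x => P.ValidAnd x ∧ P.Good₁ x

open Classical in
/-- The valid patterns with `Good₂`. -/
noncomputable def good₂AndSet : Finset (P.Term → Bool) := univ.filter fun x => P.ValidAnd x ∧ P.Good₂ x

/-- **CONJECTURE (CS) on a port problem** (C-041.md §17): `(#valid − #Good₁ − #Good₂)₊² ≤ #Good₁ · #Good₂`. -/
def CSAnd : Prop := CS #(P.validAndSet) #(P.good₁AndSet) #(P.good₂AndSet)

variable {P}

/-- Membership in the valid patterns. -/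
theorem mem_validAndSet {x : P.Term → Bool} : x ∈ P.validAndSet ↔ P.ValidAnd x := by
  classical
  unfold validAndSet
  rw [Finset.mem_filter]
  exact and_iff_right (Finset.mem_univ _)

/-- Membership in `good₁AndSet`. -/
theorem mem_good₁AndSet {x : P.Term → Bool} : x ∈ P.good₁AndSet ↔ P.ValidAnd x ∧ P.Good₁ x := by
  classical
  unfold good₁AndSet
  rw [Finset.mem_filter]
  exact and_iff_right (Finset.mem_univ _)

/-- Membership in `good₂AndSet`. -/
theorem mem_good₂AndSet {x : P.Term → Bool} : x ∈ P.good₂AndSet ↔ P.ValidAnd x ∧ P.Good₂ x := by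
  classical
  unfold good₂AndSet
  rw [Finset.mem_filter]
  exact and_iff_right (Finset.mem_univ _)

/-- `good₁AndSet ⊆ validAndSet`. -/
theorem good₁AndSet_subset : P.good₁AndSet ⊆ P.validAndSet := fun _ hx => mem_validAndSet.2 (mem_good₁AndSet.1 hx).1

/-- `good₂AndSet ⊆ validAndSet`. -/
theorem good₂AndSet_subset : P.good₂AndSet ⊆ P.validAndSet := fun _ hx => mem_validAndSet.2 (mem_good₂AndSet.1 hx).1

open Classical in
/-- `good₁AndSet` is the `Good₁`-filter of the valid patterns. -/
theorem good₁AndSet_eq_filter : P.good₁AndSet = P.validAndSet.filter fun x => P.Good₁ x := by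
  classical
  ext x
  rw [mem_good₁AndSet, Finset.mem_filter, mem_validAndSet]

open Classical in
/-- `good₂AndSet` is the `Good₂`-filter of the valid patterns. -/
theorem good₂AndSet_eq_filter : P.good₂AndSet = P.validAndSet.filter fun x => P.Good₂ x := by
  classical
  ext x
  rw [mem_good₂AndSet, Finset.mem_filter, mem_validAndSet]

open Classical in
/-- **The weight sum of THEOREM R through the counts**: `Φ∧ P = 3·#Good₁ + 3·#Good₂ − 2·#valid`. -/
theorem phiAnd_eq_counts : P.phiAnd = 3 * (#(P.good₁AndSet) : ℤ) + 3 * #(P.good₂AndSet) - 2 * #(P.validAndSet) := by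
  unfold phiAnd
  rw [← Finset.sum_filter]
  have e : (univ.filter fun x => P.Adm x ∧ (P.X₁ x ∧ P.X₂ x)) = P.validAndSet := by
    ext x
    rw [Finset.mem_filter, mem_validAndSet]
    exact and_iff_right (Finset.mem_univ _)
  rw [e, Finset.sum_congr rfl fun x _ => weight_eq_ind x, Finset.sum_sub_distrib, Finset.sum_add_distrib,
    ← Finset.mul_sum, ← Finset.mul_sum, Finset.sum_boole, Finset.sum_boole, Finset.sum_const, nsmul_eq_mul,
    ← good₁AndSet_eq_filter, ← good₂AndSet_eq_filter]
  ring

/-- **(CS) implies THE LEMMA**: `0 ≤ Φ∧ P` by AM–GM. -/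
theorem phiAnd_nonneg_of_csAnd (h : P.CSAnd) : 0 ≤ P.phiAnd := by
  rw [phiAnd_eq_counts]
  have := two_mul_le_of_cs h
  omega

/-! ## The terminal swap -/

/-- The valid patterns of the swap are as many. -/
theorem card_validAndSet_swap : #(P.swap.validAndSet) = #(P.validAndSet) := by
  refine (Finset.card_equiv P.swapPatternEquiv fun x => ?_).symm
  rw [mem_validAndSet, mem_validAndSet, swapPatternEquiv_apply, validAnd_swap]

/-- The `Good₁` patterns of the swap are the `Good₂` patterns. -/
theorem card_good₁AndSet_swap : #(P.swap.good₁AndSet) = #(P.good₂AndSet) := by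
  refine (Finset.card_equiv P.swapPatternEquiv fun x => ?_).symm
  rw [mem_good₂AndSet, mem_good₁AndSet, swapPatternEquiv_apply, validAnd_swap, good₁_swap]

/-- The `Good₂` patterns of the swap are the `Good₁` patterns. -/
theorem card_good₂AndSet_swap : #(P.swap.good₂AndSet) = #(P.good₁AndSet) := by
  refine (Finset.card_equiv P.swapPatternEquiv fun x => ?_).symm
  rw [mem_good₁AndSet, mem_good₂AndSet, swapPatternEquiv_apply, validAnd_swap, good₂_swap]

/-- **(CS) is invariant under the terminal swap.** -/
theorem csAnd_swap : P.swap.CSAnd ↔ P.CSAnd := by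
  unfold CSAnd
  rw [card_validAndSet_swap, card_good₁AndSet_swap, card_good₂AndSet_swap]
  exact ⟨cs_comm, cs_comm⟩

/-! ## Case (i): no zone -/

/-- **Case (i)**: without zones (CS) holds (every count is `0`). -/
theorem csAnd_of_Z_empty (hZ : P.Z = ∅) : P.CSAnd := by
  apply cs_of_le
  have : P.validAndSet = ∅ := by
    ext x
    rw [mem_validAndSet]
    exact ⟨fun h => absurd h (not_validAnd_of_Z_empty hZ x), fun h => absurd h (Finset.notMem_empty x)⟩
  rw [this, Finset.card_empty]
  exact Nat.zero_le _

/-! ## Case (iii): a non-switchable gate -/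

/-- **Case (iii)**: with a non-switchable gate, (CS) holds — every valid pattern is Good on the side opposite to one
of the gate's edges, so `#valid ≤ #Good₂` or `#valid ≤ #Good₁`. -/
theorem csAnd_of_forced_gate {C : Finset V} (hC : P.IsGate C) (hsw : P.sw C = false) : P.CSAnd := by
  apply cs_of_le
  obtain ⟨e, he⟩ := P.hk C hC.mem
  let e' : P.Term := ⟨e, he ▸ hC.mem⟩
  have hC' : P.IsGate (P.tz e'.1) := by
    show P.IsGate (P.tz e)
    rw [he]
    exact hC
  have hsw' : P.sw (P.tz e'.1) = false := by
    show P.sw (P.tz e) = false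
    rw [he]
    exact hsw
  cases hs : P.ts e
  · have hsub : P.validAndSet ⊆ P.good₂AndSet := fun x hx => by
      rw [mem_validAndSet] at hx
      rw [mem_good₂AndSet]
      exact ⟨hx, good₂_of_forced_gate hx.1 hC' hsw' hs⟩
    have := Finset.card_le_card hsub
    omega
  · have hsub : P.validAndSet ⊆ P.good₁AndSet := fun x hx => by
      rw [mem_validAndSet] at hx
      rw [mem_good₁AndSet]
      exact ⟨hx, good₁_of_forced_gate hx.1 hC' hsw' hs⟩
    have := Finset.card_le_card hsub
    omega

end Counts

end Problem

end ZonePort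

end PercRepro
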